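import Literature.AlgebraicGeometry.Resolution.RegularLocusDense
import Literature.AlgebraicGeometry.Resolution.ResolutionOfComponents
import Literature.AlgebraicGeometry.Resolution.BlowupsFlatBaseChange
import Literature.AlgebraicGeometry.Resolution.RegularLocalRingsProofs
import Mathlib.AlgebraicGeometry.Morphisms.Proper
import Mathlib.AlgebraicGeometry.Morphisms.Finite
import Mathlib.AlgebraicGeometry.Noetherian
import Mathlib.AlgebraicGeometry.IdealSheaf.Subscheme
import HarnessLib

/-!
# Cossart–Piltant Thm. 1.1, Step 1: reduction to the irreducible components, over `Reg X`

Topic: `Literature/AlgebraicGeometry/Resolution`. Supporting theorems for the named fact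
`CossartPiltant2019General` (`QuasiExcellentSchemes.lean`; Cossart–Piltant 2019, Thm. 1.1 as
printed) and its surface analogue `CossartJannsenSaito2020General`; the companion of
`ResolutionOfComponents.lean`, which proves the same reduction for the weaker
`Scheme.HasResolution` (no condition over the regular locus). The printed proof of Thm. 1.1 (via
Prop. 4.6 [arXiv v1: Prop. 4.4], "an enhanced version of Zariski's Patching Theorem") begins with

> Step 1: it can be assumed that `𝒳` is irreducible of dimension three. There is a finite
> birational morphism `f : ∐ᵢ 𝒳ᵢ → 𝒳`, isomorphic above `Reg 𝒳`. The theorem holds for `𝒳` if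
> it holds for each `𝒳ᵢ`.

(`𝒳₁, …, 𝒳_c` the irreducible components of the reduced Noetherian scheme `𝒳`). This file PROVES
that step, INCLUDING "isomorphic above `Reg 𝒳`" (conclusion (ii) of Thm. 1.1), for the vendored
conclusion of `CossartPiltant2019General` — a resolution `π : X' → X` (`IsResolution`: proper,
birational, regular source) which is an isomorphism over an open `U` whose points are exactly
`Reg X`:

* `exists_isResolution_regularLocus_of_closed_cover` — the glue: if the reduced scheme `X` is
  the union of two closed subschemes `C`, `D` with `C ∖ D` dense in `C`, `D ∖ C` dense in `D` and
  no regular point of `X` on `C ∩ D`, resolutions of `C` and `D` of the above kind give one of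
  `X`, namely `C' ⨿ D' → X` (proper: `isProper_coprodDesc` of `ResolutionOfComponents.lean`; an
  isomorphism over `Reg X = (Reg C ∖ D) ∪ (Reg D ∖ C)` since a closed immersion is an
  isomorphism over every open of the reduced target inside its range, `ResolutionGlue.lean`);
* `exists_isResolution_regularLocus_of_irreducibleComponents` — the induction on the number of
  irreducible components: for any property `Q` of schemes inherited by closed subschemes, if
  every integral Noetherian scheme with `Q` is resolvable in this sense then so is every reduced
  Noetherian scheme with `Q` (split off one component `Z` with its reduced structure — an
  integral scheme — from the union `Z'` of the other components; a regular point lies on a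
  single component because its local ring is a domain,
  `eq_of_mem_irreducibleComponents_of_isDomain_stalk`, Stacks 01J7 + Matsumura Thm. 14.3);
* `CossartPiltant2019General.of_integral_closedSubschemes` — **Thm. 1.1 follows from its case of
  integral closed subschemes** of reduced separated Noetherian quasi-excellent schemes of
  dimension `≤ 3`; `CossartJannsenSaito2020General.of_integral_closedSubschemes` — the same
  reduction for CJS 2020 Thm. 1.2 (reduced excellent Noetherian, dimension `≤ 2`).

Auxiliary [folklore]: `IsPreirreducible.preimage_of_isEmbedding`,
`ncard_irreducibleComponents_le_of_isEmbedding`, `isNoetherian_subscheme`; the reduced closed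
subscheme of a closed subset is Mathlib's `(IdealSheafData.vanishingIdeal Z).subscheme`, with the
API of `ResolutionOfCurves.lean` (`isReduced_/isIntegral_subscheme_vanishingIdeal`,
`range_subschemeι_vanishingIdeal`) and of `BlowupsFlatBaseChange.lean`
(`mem_regularLocus_iff_of_isIso_morphismRestrict`).

No definitions and no named facts are introduced. Not covered here (the remaining content of
Step 1 as printed): that the components `𝒳ᵢ` are again quasi-excellent (EGA IV₂ 7.8.3), which is
why the reductions are stated for integral CLOSED SUBSCHEMES of the schemes of Thm. 1.1 rather
than for integral schemes satisfying its hypotheses; and "Resolution of singularities is known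
if `dim 𝒳 ≤ 2` [L3]".

## Sources

* V. Cossart, O. Piltant, *Resolution of singularities of arithmetical threefolds*, J. Algebra
  529 (2019) 268–535 = arXiv:1412.0868, Thm. 1.1 and proof of Prop. 4.6 [v1: Prop. 4.4],
  Step 1 (v1 p. 50). [CossartPiltant2019]
* The Stacks Project, Tag 01J7 (points of `Spec 𝒪_{X,x}`). [StacksProject]
* H. Matsumura, *Commutative Ring Theory*, Thm. 14.3 (regular local rings are domains;
  `RegularLocalRingsProofs.lean`). [Matsumura1987]
-/

noncomputable section

open CategoryTheory CategoryTheory.Limits AlgebraicGeometry TopologicalSpace Topology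

namespace Literature.AlgebraicGeometry.Resolution

universe u

/-! ## Gluing resolutions along a closed cover by two closed subschemes -/

/-- **Gluing resolutions which are isomorphisms over the regular locus along a closed cover.**
Let the reduced scheme `X` be covered by two closed subschemes `ι₁ : C ↪ X`, `ι₂ : D ↪ X` such
that the complement of `D` is dense in `C`, the complement of `C` is dense in `D`, and no
regular point of `X` lies on both. If `C` and `D` admit resolutions (proper, birational, regular
source) which are isomorphisms over exactly their regular loci, so does `X`: the disjoint union
`C' ⨿ D' → X`; it is an isomorphism over `Reg X = (Reg C ∖ D) ∪ (Reg D ∖ C)`. This is the form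
of Cossart–Piltant's Step 1 in the proof of Prop. 4.6 [arXiv v1: Prop. 4.4] ("The theorem holds
for `𝒳` if it holds for each `𝒳ᵢ`") used inductively below.
[cite: CossartPiltant2019, proof of Prop. 4.6, Step 1] -/
theorem exists_isResolution_regularLocus_of_closed_cover {C D X : Scheme.{u}} [IsReduced X]
    (ι₁ : C ⟶ X) (ι₂ : D ⟶ X) [IsClosedImmersion ι₁] [IsClosedImmersion ι₂]
    (hcov : Set.range ι₁ ∪ Set.range ι₂ = Set.univ)
    (hd₁ : Dense (ι₁ ⁻¹' (Set.range ι₂)ᶜ)) (hd₂ : Dense (ι₂ ⁻¹' (Set.range ι₁)ᶜ))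
    (hreg : ∀ x ∈ Scheme.regularLocus X, x ∈ Set.range ι₁ → x ∉ Set.range ι₂)
    (h₁ : ∃ (C' : Scheme.{u}) (ρ : C' ⟶ C), IsResolution ρ ∧
      ∃ U : C.Opens, (U : Set C) = Scheme.regularLocus C ∧ IsIso (ρ ∣_ U))
    (h₂ : ∃ (D' : Scheme.{u}) (ρ : D' ⟶ D), IsResolution ρ ∧
      ∃ U : D.Opens, (U : Set D) = Scheme.regularLocus D ∧ IsIso (ρ ∣_ U)) :
    ∃ (X' : Scheme.{u}) (π : X' ⟶ X), IsResolution π ∧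
      ∃ U : X.Opens, (U : Set X) = Scheme.regularLocus X ∧ IsIso (π ∣_ U) := by
  obtain ⟨C', ρ₁, ⟨hpr₁, ⟨W₁, -, hW₁', hisoW₁⟩, hreg₁⟩, U₁, hU₁, hiso₁⟩ := h₁
  obtain ⟨D', ρ₂, ⟨hpr₂, ⟨W₂, -, hW₂', hisoW₂⟩, hreg₂⟩, U₂, hU₂, hiso₂⟩ := h₂
  -- the open complements of the two closed pieces
  let A : X.Opens := ⟨(Set.range ι₂)ᶜ, ι₂.isClosedEmbedding.isClosed_range.isOpen_compl⟩
  let B : X.Opens := ⟨(Set.range ι₁)ᶜ, ι₁.isClosedEmbedding.isClosed_range.isOpen_compl⟩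
  have hA : (A : Set X) ⊆ Set.range ι₁ := by
    intro x hx
    have hx' : x ∈ Set.range ι₁ ∪ Set.range ι₂ := by rw [hcov]; trivial
    exact hx'.resolve_right hx
  have hB : (B : Set X) ⊆ Set.range ι₂ := by
    intro x hx
    have hx' : x ∈ Set.range ι₁ ∪ Set.range ι₂ := by rw [hcov]; trivial
    exact hx'.resolve_left hx
  -- the closed immersions are isomorphisms over `A`, `B`; regular loci correspond there
  haveI eA : IsIso (ι₁ ∣_ A) := isIso_morphismRestrict_of_isClosedImmersion ι₁ A hA
  haveI eB : IsIso (ι₂ ∣_ B) := isIso_morphismRestrict_of_isClosedImmersion ι₂ B hB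
  have regC : ∀ c : C, ι₁ c ∈ A →
      (c ∈ Scheme.regularLocus C ↔ ι₁ c ∈ Scheme.regularLocus X) :=
    fun c hc => mem_regularLocus_iff_of_isIso_morphismRestrict ι₁ A c hc
  have regD : ∀ d : D, ι₂ d ∈ B →
      (d ∈ Scheme.regularLocus D ↔ ι₂ d ∈ Scheme.regularLocus X) :=
    fun d hd => mem_regularLocus_iff_of_isIso_morphismRestrict ι₂ B d hd
  -- opens of `X` inducing `U₁`, `U₂`
  obtain ⟨O₁, hO₁, hO₁U⟩ := ι₁.isClosedEmbedding.isInducing.isOpen_iff.mp U₁.2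
  obtain ⟨O₂, hO₂, hO₂U⟩ := ι₂.isClosedEmbedding.isInducing.isOpen_iff.mp U₂.2
  let V₁ : X.Opens := ⟨O₁, hO₁⟩ ⊓ A
  let V₂ : X.Opens := ⟨O₂, hO₂⟩ ⊓ B
  have hV₁U : ι₁ ⁻¹ᵁ V₁ ≤ U₁ := by
    intro c hc
    have hc' : ι₁ c ∈ O₁ := hc.1
    have : c ∈ ι₁ ⁻¹' O₁ := hc'
    rw [hO₁U] at this
    exact this
  have hV₂U : ι₂ ⁻¹ᵁ V₂ ≤ U₂ := by
    intro d hd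
    have hd' : ι₂ d ∈ O₂ := hd.1
    have : d ∈ ι₂ ⁻¹' O₂ := hd'
    rw [hO₂U] at this
    exact this
  have hU₁V : ∀ c : C, c ∈ U₁ → ι₁ c ∈ A → ι₁ c ∈ V₁ := by
    intro c hc hcA
    refine ⟨?_, hcA⟩
    have : c ∈ ι₁ ⁻¹' O₁ := by rw [hO₁U]; exact hc
    exact this
  have hU₂V : ∀ d : D, d ∈ U₂ → ι₂ d ∈ B → ι₂ d ∈ V₂ := by
    intro d hd hdB
    refine ⟨?_, hdB⟩
    have : d ∈ ι₂ ⁻¹' O₂ := by rw [hO₂U]; exact hd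
    exact this
  -- `Reg X = V₁ ∪ V₂`
  have hRegX : ((V₁ ⊔ V₂ : X.Opens) : Set X) = Scheme.regularLocus X := by
    apply le_antisymm
    · rintro x (hx | hx)
      · obtain ⟨c, rfl⟩ := hA hx.2
        have hc : c ∈ Scheme.regularLocus C := by
          rw [← hU₁]; exact hV₁U hx
        exact (regC c hx.2).mp hc
      · obtain ⟨d, rfl⟩ := hB hx.2
        have hd : d ∈ Scheme.regularLocus D := by
          rw [← hU₂]; exact hV₂U hx
        exact (regD d hx.2).mp hd
    · intro x hx
      have hx' : x ∈ Set.range ι₁ ∪ Set.range ι₂ := by rw [hcov]; trivial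
      rcases hx' with ⟨c, rfl⟩ | ⟨d, rfl⟩
      · have hcA : ι₁ c ∈ A := hreg _ hx ⟨c, rfl⟩
        have hcU : c ∈ U₁ := by
          rw [← SetLike.mem_coe, hU₁]; exact (regC c hcA).mpr hx
        exact Or.inl (hU₁V c hcU hcA)
      · by_cases hd : ι₂ d ∈ Set.range ι₁
        · exact absurd ⟨d, rfl⟩ (hreg _ hx hd)
        · have hdB : ι₂ d ∈ B := hd
          have hdU : d ∈ U₂ := by
            rw [← SetLike.mem_coe, hU₂]; exact (regD d hdB).mpr hx
          exact Or.inr (hU₂V d hdU hdB)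
  -- the resolution: the disjoint union
  haveI := hpr₁
  haveI := hpr₂
  let π : C' ⨿ D' ⟶ X := coprod.desc (ρ₁ ≫ ι₁) (ρ₂ ≫ ι₂)
  have hπ₁ : ∀ c' : C', π ((coprod.inl : C' ⟶ C' ⨿ D') c') = ι₁ (ρ₁ c') := by
    intro c'
    rw [← Scheme.Hom.comp_apply, coprod.inl_desc, Scheme.Hom.comp_apply]
  have hπ₂ : ∀ d' : D', π ((coprod.inr : D' ⟶ C' ⨿ D') d') = ι₂ (ρ₂ d') := by
    intro d'
    rw [← Scheme.Hom.comp_apply, coprod.inr_desc, Scheme.Hom.comp_apply]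
  have hproper : IsProper π := isProper_coprodDesc _ _
  -- `π` is an isomorphism over `V₁ ∪ V₂`
  have hisoπ : IsIso (π ∣_ (V₁ ⊔ V₂)) := by
    refine isIso_morphismRestrict_sup π ?_ ?_
    · refine isIso_morphismRestrict_coprodDesc_left _ _ V₁ (fun d' h => ?_) ?_
      · rw [Scheme.Hom.comp_apply] at h
        exact h.2 ⟨ρ₂ d', rfl⟩
      · rw [morphismRestrict_comp]
        have e1 : IsIso (ρ₁ ∣_ ι₁ ⁻¹ᵁ V₁) := isIso_morphismRestrict_of_le ρ₁ hiso₁ hV₁U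
        have e2 : IsIso (ι₁ ∣_ V₁) :=
          isIso_morphismRestrict_of_isClosedImmersion ι₁ V₁ fun x hx => hA hx.2
        exact @IsIso.comp_isIso _ _ _ _ _ _ _ e1 e2
    · refine isIso_morphismRestrict_coprodDesc_right _ _ V₂ (fun c' h => ?_) ?_
      · rw [Scheme.Hom.comp_apply] at h
        exact h.2 ⟨ρ₁ c', rfl⟩
      · rw [morphismRestrict_comp]
        have e1 : IsIso (ρ₂ ∣_ ι₂ ⁻¹ᵁ V₂) := isIso_morphismRestrict_of_le ρ₂ hiso₂ hV₂U
        have e2 : IsIso (ι₂ ∣_ V₂) :=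
          isIso_morphismRestrict_of_isClosedImmersion ι₂ V₂ fun x hx => hB hx.2
        exact @IsIso.comp_isIso _ _ _ _ _ _ _ e1 e2
  -- the regular points of `C` off `D` are dense in `C` (and symmetrically)
  have hS₁ : Dense ((U₁ : Set C) ∩ ι₁ ⁻¹' (A : Set X)) := by
    rw [dense_iff_inter_open]
    rintro O hO ⟨c, hc⟩
    obtain ⟨c₁, hc₁O, hc₁A⟩ := hd₁.inter_open_nonempty O hO ⟨c, hc⟩
    obtain ⟨O', hO', hO'O⟩ := ι₁.isClosedEmbedding.isInducing.isOpen_iff.mp hO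
    have hne : (O' ∩ (A : Set X) ∩ Scheme.regularLocus X).Nonempty := by
      refine (Scheme.dense_regularLocus X).inter_open_nonempty (O' ∩ A) (hO'.inter A.2)
        ⟨ι₁ c₁, ?_, hc₁A⟩
      have : c₁ ∈ ι₁ ⁻¹' O' := by rw [hO'O]; exact hc₁O
      exact this
    obtain ⟨x, ⟨hxO', hxA⟩, hxreg⟩ := hne
    obtain ⟨c₂, rfl⟩ := hA hxA
    refine ⟨c₂, ?_, ?_, hxA⟩
    · show c₂ ∈ O
      rw [← hO'O]; exact hxO'
    · rw [hU₁]; exact (regC c₂ hxA).mpr hxreg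
  have hS₂ : Dense ((U₂ : Set D) ∩ ι₂ ⁻¹' (B : Set X)) := by
    rw [dense_iff_inter_open]
    rintro O hO ⟨d, hd⟩
    obtain ⟨d₁, hd₁O, hd₁B⟩ := hd₂.inter_open_nonempty O hO ⟨d, hd⟩
    obtain ⟨O', hO', hO'O⟩ := ι₂.isClosedEmbedding.isInducing.isOpen_iff.mp hO
    have hne : (O' ∩ (B : Set X) ∩ Scheme.regularLocus X).Nonempty := by
      refine (Scheme.dense_regularLocus X).inter_open_nonempty (O' ∩ B) (hO'.inter B.2)
        ⟨ι₂ d₁, ?_, hd₁B⟩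
      have : d₁ ∈ ι₂ ⁻¹' O' := by rw [hO'O]; exact hd₁O
      exact this
    obtain ⟨x, ⟨hxO', hxB⟩, hxreg⟩ := hne
    obtain ⟨d₂, rfl⟩ := hB hxB
    refine ⟨d₂, ?_, ?_, hxB⟩
    · show d₂ ∈ O
      rw [← hO'O]; exact hxO'
    · rw [hU₂]; exact (regD d₂ hxB).mpr hxreg
  -- hence the preimage of `V₁ ∪ V₂` is dense upstairs
  have hT₁ : Dense (ρ₁ ⁻¹' ((W₁ : Set C) ∩ ((U₁ : Set C) ∩ ι₁ ⁻¹' (A : Set X)))) :=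
    dense_preimage_inter_of_isIso_morphismRestrict ρ₁ hisoW₁ hW₁' hS₁
  have hT₂ : Dense (ρ₂ ⁻¹' ((W₂ : Set D) ∩ ((U₂ : Set D) ∩ ι₂ ⁻¹' (B : Set X)))) :=
    dense_preimage_inter_of_isIso_morphismRestrict ρ₂ hisoW₂ hW₂' hS₂
  have hdense : Dense ((π ⁻¹ᵁ (V₁ ⊔ V₂) : (C' ⨿ D').Opens) : Set ↑(C' ⨿ D')) := by
    refine (dense_inl_image_union_inr_image hT₁ hT₂).mono ?_
    rintro z (⟨c', ⟨-, hc'U, hc'A⟩, rfl⟩ | ⟨d', ⟨-, hd'U, hd'B⟩, rfl⟩)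
    · show π ((coprod.inl : C' ⟶ C' ⨿ D') c') ∈ V₁ ⊔ V₂
      rw [hπ₁]
      exact Or.inl (hU₁V _ hc'U hc'A)
    · show π ((coprod.inr : D' ⟶ C' ⨿ D') d') ∈ V₁ ⊔ V₂
      rw [hπ₂]
      exact Or.inr (hU₂V _ hd'U hd'B)
  haveI := hisoπ
  exact ⟨C' ⨿ D', π,
    ⟨hproper, isBirational_of_isIso_restrict π (V₁ ⊔ V₂) hRegX.ge hdense, hreg₁.coprod hreg₂⟩,
    V₁ ⊔ V₂, hRegX, hisoπ⟩

/-! ## Topology: embeddings and irreducible components -/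

section Topology

variable {α β : Type*} [TopologicalSpace α] [TopologicalSpace β]

/-- The preimage under an embedding of a preirreducible set contained in its range is
preirreducible. [folklore] -/
theorem IsPreirreducible.preimage_of_isEmbedding {e : β → α} (he : IsEmbedding e) {t : Set α}
    (ht : IsPreirreducible t) (hte : t ⊆ Set.range e) : IsPreirreducible (e ⁻¹' t) := by
  intro u v hu hv h₁ h₂
  obtain ⟨y₁, hy₁t, hy₁u⟩ := h₁
  obtain ⟨y₂, hy₂t, hy₂v⟩ := h₂
  obtain ⟨u', hu', rfl⟩ := he.isInducing.isOpen_iff.mp hu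
  obtain ⟨v', hv', rfl⟩ := he.isInducing.isOpen_iff.mp hv
  obtain ⟨x, hxt, hxu', hxv'⟩ := ht u' v' hu' hv' ⟨e y₁, hy₁t, hy₁u⟩ ⟨e y₂, hy₂t, hy₂v⟩
  obtain ⟨y, rfl⟩ := hte hxt
  exact ⟨y, hxt, hxu', hxv'⟩

/-- If a space `β` is embedded onto the union of a finite family `𝒮` of irreducible components
of `α`, then every irreducible component of `β` is the preimage of a member of `𝒮`; in
particular `β` has at most `|𝒮|` irreducible components. [folklore] -/
theorem ncard_irreducibleComponents_le_of_isEmbedding {e : β → α} (he : IsEmbedding e)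
    {𝒮 : Set (Set α)} (h𝒮 : 𝒮 ⊆ irreducibleComponents α) (hfin : 𝒮.Finite)
    (hrange : Set.range e = ⋃₀ 𝒮) :
    (irreducibleComponents β).ncard ≤ 𝒮.ncard := by
  classical
  refine Set.ncard_le_ncard_of_injOn (fun T => e '' T) ?_ ?_ hfin
  · intro T hT
    -- `T` lies in the preimage of one member of `𝒮`
    have hcov : T ⊆ ⋃₀ (((fun S => e ⁻¹' S) '' 𝒮) : Set (Set β)) := by
      intro y _
      have hy : e y ∈ ⋃₀ 𝒮 := hrange ▸ Set.mem_range_self y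
      obtain ⟨S, hS, hyS⟩ := hy
      exact ⟨e ⁻¹' S, ⟨S, hS, rfl⟩, hyS⟩
    have hclosed : ∀ W ∈ (hfin.image (fun S => e ⁻¹' S)).toFinset, IsClosed W := by
      intro W hW
      rw [Set.Finite.mem_toFinset] at hW
      obtain ⟨S, hS, rfl⟩ := hW
      exact (isClosed_of_mem_irreducibleComponents S (h𝒮 hS)).preimage he.continuous
    obtain ⟨W, hW, hTW⟩ := isIrreducible_iff_sUnion_isClosed.mp hT.1
      (hfin.image (fun S => e ⁻¹' S)).toFinset hclosed (by simpa using hcov)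
    rw [Set.Finite.mem_toFinset] at hW
    obtain ⟨S, hS, rfl⟩ := hW
    have hSe : S ⊆ Set.range e := hrange ▸ Set.subset_sUnion_of_mem hS
    have hirr : IsIrreducible (e ⁻¹' S) :=
      ⟨hT.1.nonempty.mono hTW, IsPreirreducible.preimage_of_isEmbedding he (h𝒮 hS).1.2 hSe⟩
    have hTS : T = e ⁻¹' S := hTW.antisymm (hT.2 hirr hTW)
    show e '' T ∈ 𝒮
    rw [hTS, Set.image_preimage_eq_of_subset hSe]
    exact hS
  · intro T₁ _ T₂ _ h
    exact (Set.image_injective.mpr he.injective) h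

/-- A point whose local ring is a domain lies on a single irreducible component: the image of
`Spec 𝒪_{X,x} → X` is the set of generizations of `x` (Stacks 01J7), an irreducible set
containing the generic points of all components through `x`. [cite: StacksProject, Tag 01J7] -/
private theorem eq_of_mem_irreducibleComponents_of_isDomain_stalk' {X : Scheme.{u}} (x : X)
    [IsDomain (X.presheaf.stalk x)] {Z₁ Z₂ : Set X} (h₁ : Z₁ ∈ irreducibleComponents X)
    (h₂ : Z₂ ∈ irreducibleComponents X) (hx₁ : x ∈ Z₁) (hx₂ : x ∈ Z₂) : Z₁ = Z₂ := by
  -- the generizations of `x` form an irreducible set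
  set S : Set X := Set.range (X.fromSpecStalk x) with hSdef
  have hS : S = {y | y ⤳ x} := Scheme.range_fromSpecStalk
  have hSirr : IsPreirreducible S := by
    rw [hSdef, ← Set.image_univ]
    exact (IrreducibleSpace.isIrreducible_univ _).2.image _
      (X.fromSpecStalk x).continuous.continuousOn
  -- every irreducible component through `x` lies in its closure
  have key : ∀ Z ∈ irreducibleComponents X, x ∈ Z → Z ⊆ closure S := by
    intro Z hZ hxZ
    obtain ⟨ξ, hξ⟩ := QuasiSober.sober hZ.1 (isClosed_of_mem_irreducibleComponents Z hZ)
    have hξx : ξ ⤳ x := by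
      rw [specializes_iff_mem_closure, hξ]
      exact hxZ
    have hξS : ξ ∈ S := by rw [hS]; exact hξx
    rw [← hξ]
    exact closure_mono (Set.singleton_subset_iff.mpr hξS)
  have hT : IsIrreducible (closure S) :=
    IsIrreducible.closure ⟨⟨x, by rw [hS]; exact specializes_rfl⟩, hSirr⟩
  have h₁T : closure S ⊆ Z₁ := h₁.2 hT (key Z₁ h₁ hx₁)
  have h₂₁ : Z₂ ⊆ Z₁ := (key Z₂ h₂ hx₂).trans h₁T
  exact (h₂.2 h₁.1 h₂₁).antisymm h₂₁

end Topology

/-! ## Closed subschemes of Noetherian schemes -/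

/-- A closed subscheme of a Noetherian scheme is Noetherian. [folklore] -/
theorem isNoetherian_subscheme {X : Scheme.{u}} [IsNoetherian X] (I : X.IdealSheafData) :
    IsNoetherian I.subscheme := by
  haveI : IsLocallyNoetherian I.subscheme := LocallyOfFiniteType.isLocallyNoetherian I.subschemeι
  haveI : CompactSpace I.subscheme := QuasiCompact.compactSpace_of_compactSpace I.subschemeι
  exact {}

/-! ## Step 1: reduction to the irreducible components -/

/-- **Resolution of a reduced Noetherian scheme from resolutions of its irreducible
components** (Cossart–Piltant 2019, proof of Prop. 4.6 [arXiv v1: 4.4], Step 1: "There is a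
finite birational morphism `∐ᵢ 𝒳ᵢ → 𝒳`, isomorphic above `Reg 𝒳`. The theorem holds for `𝒳` if
it holds for each `𝒳ᵢ`"). Abstract form: let `Q` be a property of schemes inherited by closed
subschemes. If every integral Noetherian scheme with `Q` admits a resolution which is an
isomorphism over exactly its regular locus, then so does every reduced Noetherian scheme with
`Q` — by induction on the number of irreducible components, splitting off one component `Z`
(with its reduced structure, an integral scheme) from the union `Z'` of the others (reduced
structure, fewer components) and gluing with
`exists_isResolution_regularLocus_of_closed_cover`: `Z ∖ Z'` is dense in `Z`, `Z' ∖ Z` is dense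
in `Z'`, and a regular point of `X` lies on a single component.
[cite: CossartPiltant2019, proof of Prop. 4.6, Step 1] -/
theorem exists_isResolution_regularLocus_of_irreducibleComponents (Q : Scheme.{u} → Prop)
    (hQ : ∀ ⦃X Y : Scheme.{u}⦄ (i : Y ⟶ X), IsClosedImmersion i → Q X → Q Y)
    (hirr : ∀ (X : Scheme.{u}) [IsIntegral X] [IsNoetherian X], Q X →
      ∃ (X' : Scheme.{u}) (π : X' ⟶ X), IsResolution π ∧
        ∃ U : X.Opens, (U : Set X) = Scheme.regularLocus X ∧ IsIso (π ∣_ U))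
    (X : Scheme.{u}) [IsNoetherian X] [IsReduced X] (hX : Q X) :
    ∃ (X' : Scheme.{u}) (π : X' ⟶ X), IsResolution π ∧
      ∃ U : X.Opens, (U : Set X) = Scheme.regularLocus X ∧ IsIso (π ∣_ U) := by
  -- strong induction on the number of irreducible components
  suffices key : ∀ (n : ℕ) (X : Scheme.{u}) [IsNoetherian X] [IsReduced X], Q X →
      (irreducibleComponents X).ncard = n →
        ∃ (X' : Scheme.{u}) (π : X' ⟶ X), IsResolution π ∧
          ∃ U : X.Opens, (U : Set X) = Scheme.regularLocus X ∧ IsIso (π ∣_ U) from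
    key _ X hX rfl
  intro n
  induction n using Nat.strong_induction_on with
  | _ n ih => ?_
  intro X _ _ hX hn
  rcases isEmpty_or_nonempty X with hXe | ⟨⟨x⟩⟩
  · exact exists_isResolution_of_isRegular fun x => isEmptyElim x
  -- the component `Z` of `x` and the union `Z'` of the other components
  have hfin : (irreducibleComponents X).Finite := NoetherianSpace.finite_irreducibleComponents
  set Z : Set X := irreducibleComponent x with hZdef
  have hZ : Z ∈ irreducibleComponents X := irreducibleComponent_mem_irreducibleComponents x
  set Others : Set (Set X) := irreducibleComponents X \ {Z} with hOthersdef
  have hOsub : Others ⊆ irreducibleComponents X := Set.sdiff_subset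
  have hOfin : Others.Finite := hfin.subset hOsub
  have hOne : ∀ W ∈ Others, W ≠ Z := fun W hW h => hW.2 h
  set Z' : Set X := ⋃₀ Others with hZ'def
  have hZc : IsClosed Z := isClosed_of_mem_irreducibleComponents Z hZ
  have hZ'c : IsClosed Z' := by
    rw [hZ'def, Set.sUnion_eq_biUnion]
    exact hOfin.isClosed_biUnion fun W hW => isClosed_of_mem_irreducibleComponents W (hOsub hW)
  have hZZ' : Z ∪ Z' = Set.univ := by
    rw [hZ'def, ← Set.sUnion_insert, hOthersdef, Set.insert_sdiff_singleton,
      Set.insert_eq_of_mem hZ, sUnion_irreducibleComponents]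
  have hZnot : ¬ Z ⊆ Z' := fun h =>
    hOne Z (mem_of_subset_sUnion_irreducibleComponents Z hZ Others hOfin hOsub h) rfl
  have hWnot : ∀ W ∈ Others, ¬ W ⊆ Z := fun W hW h =>
    hOne W hW ((h.antisymm ((hOsub hW).2 hZ.1 h)))
  -- the reduced closed subschemes `C ↪ X` on `Z` and `D ↪ X` on `Z'`
  set I₁ : X.IdealSheafData := Scheme.IdealSheafData.vanishingIdeal ⟨Z, hZc⟩ with hI₁
  set I₂ : X.IdealSheafData := Scheme.IdealSheafData.vanishingIdeal ⟨Z', hZ'c⟩ with hI₂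
  have hr₁ : Set.range I₁.subschemeι = Z := range_subschemeι_vanishingIdeal ⟨Z, hZc⟩
  have hr₂ : Set.range I₂.subschemeι = Z' := range_subschemeι_vanishingIdeal ⟨Z', hZ'c⟩
  haveI : IsReduced I₂.subscheme := isReduced_subscheme_vanishingIdeal _
  haveI : IsNoetherian I₁.subscheme := isNoetherian_subscheme _
  haveI : IsNoetherian I₂.subscheme := isNoetherian_subscheme _
  haveI : IsIntegral I₁.subscheme := isIntegral_subscheme_vanishingIdeal ⟨Z, hZc⟩ hZ.1
  -- the hypotheses of the glue
  have hcov : Set.range I₁.subschemeι ∪ Set.range I₂.subschemeι = Set.univ := by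
    rw [hr₁, hr₂, hZZ']
  have hd₁ : Dense (I₁.subschemeι ⁻¹' (Set.range I₂.subschemeι)ᶜ) := by
    rw [hr₂]
    refine IsOpen.dense (hZ'c.isOpen_compl.preimage I₁.subschemeι.continuous) ?_
    obtain ⟨z, hzZ, hzZ'⟩ := Set.not_subset.mp hZnot
    rw [← hr₁] at hzZ
    obtain ⟨c, rfl⟩ := hzZ
    exact ⟨c, hzZ'⟩
  have hd₂ : Dense (I₂.subschemeι ⁻¹' (Set.range I₁.subschemeι)ᶜ) := by
    rw [hr₁, dense_iff_inter_open]
    rintro O hO ⟨d, hd⟩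
    obtain ⟨O', hO', hO'O⟩ := I₂.subschemeι.isClosedEmbedding.isInducing.isOpen_iff.mp hO
    have hdZ' : I₂.subschemeι d ∈ Z' := hr₂ ▸ Set.mem_range_self d
    obtain ⟨W, hW, hdW⟩ := hdZ'
    have hWO' : (W ∩ O').Nonempty := ⟨_, hdW, by
      have : d ∈ I₂.subschemeι ⁻¹' O' := by rw [hO'O]; exact hd
      exact this⟩
    have hWZ : (W ∩ Zᶜ).Nonempty := Set.inter_compl_nonempty_iff.mpr (hWnot W hW)
    obtain ⟨y, hyW, hyO', hyZ⟩ := (hOsub hW).1.2 O' Zᶜ hO' hZc.isOpen_compl hWO' hWZ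
    have hyZ' : y ∈ Set.range I₂.subschemeι := hr₂ ▸ ⟨W, hW, hyW⟩
    obtain ⟨d', rfl⟩ := hyZ'
    refine ⟨d', ?_, hyZ⟩
    show d' ∈ O
    rw [← hO'O]; exact hyO'
  have hreg : ∀ y ∈ Scheme.regularLocus X, y ∈ Set.range I₁.subschemeι →
      y ∉ Set.range I₂.subschemeι := by
    intro y hy hy₁ hy₂
    rw [hr₁] at hy₁
    rw [hr₂] at hy₂
    obtain ⟨W, hW, hyW⟩ := hy₂
    haveI : IsRegularLocalRing (X.presheaf.stalk y) := hy
    haveI : IsDomain (X.presheaf.stalk y) := isDomain_of_isRegularLocalRing _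
    exact hOne W hW (eq_of_mem_irreducibleComponents_of_isDomain_stalk' y (hOsub hW) hZ hyW hy₁)
  -- resolutions of the two pieces: `C` is integral, `D` has fewer components
  have h₁ := hirr I₁.subscheme (hQ I₁.subschemeι inferInstance hX)
  have hlt : (irreducibleComponents I₂.subscheme).ncard < n := by
    have hle : (irreducibleComponents I₂.subscheme).ncard ≤ Others.ncard :=
      ncard_irreducibleComponents_le_of_isEmbedding
        I₂.subschemeι.isClosedEmbedding.isEmbedding hOsub hOfin hr₂
    have hO : Others.ncard = n - 1 := by
      rw [hOthersdef, Set.ncard_sdiff_singleton_of_mem hZ, hn]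
    have hn1 : 1 ≤ n := by
      rw [← hn]
      exact (Set.ncard_pos hfin).mpr ⟨Z, hZ⟩
    omega
  have h₂ := ih _ hlt I₂.subscheme (hQ I₂.subschemeι inferInstance hX) rfl
  exact exists_isResolution_regularLocus_of_closed_cover I₁.subschemeι I₂.subschemeι hcov hd₁ hd₂
    hreg h₁ h₂

/-- **Cossart–Piltant Thm. 1.1 reduces to integral schemes** (proof of Prop. 4.6
[arXiv v1: 4.4], Step 1: "it can be assumed that `𝒳` is irreducible"): if every INTEGRAL closed
subscheme of every reduced separated Noetherian quasi-excellent scheme of dimension `≤ 3` admits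
a resolution which is an isomorphism over exactly its regular locus, then
`CossartPiltant2019General` holds. [cite: CossartPiltant2019, proof of Prop. 4.6, Step 1] -/
theorem CossartPiltant2019General.of_integral_closedSubschemes
    (H : ∀ (T : Scheme.{u}) [T.IsSeparated] [IsNoetherian T] [IsReduced T],
      Scheme.IsQuasiExcellent T → topologicalKrullDim T ≤ 3 →
      ∀ (Y : Scheme.{u}) (i : Y ⟶ T) [IsClosedImmersion i] [IsIntegral Y],
        ∃ (Y' : Scheme.{u}) (π : Y' ⟶ Y), IsResolution π ∧
          ∃ U : Y.Opens, (U : Set Y) = Scheme.regularLocus Y ∧ IsIso (π ∣_ U)) :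
    CossartPiltant2019General.{u} := by
  intro X _ _ _ hqe hdim
  refine exists_isResolution_regularLocus_of_irreducibleComponents
    (fun Y => ∃ i : Y ⟶ X, IsClosedImmersion i) ?_ ?_ X ⟨𝟙 X, inferInstance⟩
  · rintro X' Y i hi ⟨j, hj⟩
    exact ⟨i ≫ j, inferInstance⟩
  · rintro Y _ _ ⟨j, hj⟩
    exact H X hqe hdim Y j

/-- **Cossart–Jannsen–Saito Thm. 1.2 reduces to integral schemes** in the same way: if every
integral closed subscheme of every reduced excellent Noetherian scheme of dimension `≤ 2` admits
a resolution which is an isomorphism over exactly its regular locus, then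
`CossartJannsenSaito2020General` holds. [cite: CossartPiltant2019, proof of Prop. 4.6, Step 1] -/
theorem CossartJannsenSaito2020General.of_integral_closedSubschemes
    (H : ∀ (T : Scheme.{u}) [IsNoetherian T] [IsReduced T],
      Scheme.IsExcellent T → topologicalKrullDim T ≤ 2 →
      ∀ (Y : Scheme.{u}) (i : Y ⟶ T) [IsClosedImmersion i] [IsIntegral Y],
        ∃ (Y' : Scheme.{u}) (π : Y' ⟶ Y), IsResolution π ∧
          ∃ U : Y.Opens, (U : Set Y) = Scheme.regularLocus Y ∧ IsIso (π ∣_ U)) :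
    CossartJannsenSaito2020General.{u} := by
  intro X _ _ hexc hdim
  refine exists_isResolution_regularLocus_of_irreducibleComponents
    (fun Y => ∃ i : Y ⟶ X, IsClosedImmersion i) ?_ ?_ X ⟨𝟙 X, inferInstance⟩
  · rintro X' Y i hi ⟨j, hj⟩
    exact ⟨i ≫ j, inferInstance⟩
  · rintro Y _ _ ⟨j, hj⟩
    exact H X hexc hdim Y j

end Literature.AlgebraicGeometry.Resolution

end
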